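import Mathlib
import Summits.QuantumAdvantage.QuantumAdvantage.Theorems.MobiusLadderQuadraticDigitPhasesStubCondCount
import Summits.QuantumAdvantage.QuantumAdvantage.Theorems.MobiusLadderQuadraticDigitPhasesStubDigitFunctional
import Summits.QuantumAdvantage.QuantumAdvantage.Theorems.MobiusLadderQuadraticDigitPhasesStubFlipGood

/-!
# Tame core campaign, file 2: the window count with a perturbed half-flip (toward `stub_tameCore`)

Helper file of the campaign proving the registered stub `stub_tameCore` of the crux
`MobiusLadder.QuadraticDigitPhases` (stmt-QuantumAdvantage-1391), line `Sketch`.  Mathlib plus the landed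
siblings `…StubCondCount` (conditional window counting), `…StubDigitFunctional` (`card_parity_ge`,
`card_filter_periodic`, `le_two_mul_of_le`, `cast_half_add_odd`) and `…StubFlipGood` (blockwise XOR).

The events of the tame core are zero sets of `𝔽₂`-valued functions `F` of the input `T` with a PIVOT `m`:
`F` only sees `T mod 2^(m+1)`, and flipping the input bit `m - 1` changes `F` by
`⌊p (T mod 2^(m-1))/2^(m-1)⌋ + ⌊q (T mod 2^(m-1))/2^(m-1)⌋ + D(T mod 2^(m-2))` (mod 2) — the two carries into
position `m - 1` plus a PERTURBATION `D` that only sees the bits below `m - 2` (in the application `D` is a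
constant plus the top pattern bits of a critical junk window).  We show that such an `F` vanishes on at most a
`(1 - 1/(8pq))`-fraction of every window class (`window_bound`), and feed this into `stub_condCount`
(`count_events`): `#{T < 2^N : F_j(T) = 0 ∀ j} ≤ (1 - 1/(8pq))^d 2^N` for `d` such events with pivots
increasing by more than `k`, `2^(k-2) ≥ 4pq`.

The window count (`window_pairing`) is a TWO-LEVEL PAIRING: `w ↔ w ⊕ 2^(k-1)` changes `f` by
`Δ(w) = ρ + ρ' + E(w mod 2^(k-2))`, so `f` takes each value on at least half of `{Δ = 1}` (`card_le_two_mul_of_flip`);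
and `w ↔ w ⊕ 2^(k-2)` changes `Δ` by `ρ₂ + ρ₂' + (p-1)/2 + (q-1)/2` (carry recursion, `carry_cast_flip`), whose
value `1` has density `≥ 1/(pq) - 2^-(k-2)` by `card_parity_ge` (distinct `p`, `q`).
-/

set_option linter.dupNamespace false -- D-0017: single-problem summit ⇒ `QuantumAdvantage.QuantumAdvantage` by design

namespace Summit.QuantumAdvantage.QuantumAdvantage.Theorems.MobiusLadderQuadraticDigitPhasesStubTameCoreWindow

open Finset
open Summit.QuantumAdvantage.QuantumAdvantage.Theorems.MobiusLadderQuadraticDigitPhasesStubCondCount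
  (stub_condCount sub_window)
open Summit.QuantumAdvantage.QuantumAdvantage.Theorems.MobiusLadderQuadraticDigitPhasesStubDigitFunctional
  (card_parity_ge card_filter_periodic le_two_mul_of_le cast_half_add_odd)
open Summit.QuantumAdvantage.QuantumAdvantage.Theorems.MobiusLadderQuadraticDigitPhasesStubFlipGood
  (xor_blocks xor_two_pow_mod_of_le xor_two_pow_div_of_lt)

/-! ## Pairing and periodic counting -/

/-- XOR PAIRING COUNT: if `P` is invariant under `w ↦ w ⊕ 2^j` (`j < K`) and `f` changes by `1` along this
involution on `P`, then `f` takes every value on at least half of `{w < 2^K : P w}`. -/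
theorem card_le_two_mul_of_flip (K j : ℕ) (hj : j < K) (f : ℕ → ZMod 2) (P : ℕ → Prop) [DecidablePred P]
    (hP : ∀ w, w < 2 ^ K → P w → P (w ^^^ 2 ^ j))
    (hf : ∀ w, w < 2 ^ K → P w → f (w ^^^ 2 ^ j) = f w + 1) (v : ZMod 2) :
    ((range (2 ^ K)).filter P).card ≤ 2 * ((range (2 ^ K)).filter (fun w => f w = v)).card := by
  have flip : ∀ a w : ZMod 2, a ≠ w → a + 1 = w := by decide
  have h2K : 2 ^ j < 2 ^ K := Nat.pow_lt_pow_right (by norm_num) hj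
  set S := (range (2 ^ K)).filter P with hS
  have hsplit := card_filter_add_card_filter_not (s := S) (fun w => f w = v)
  have hinj : (S.filter (fun w => ¬ f w = v)).card ≤ (S.filter (fun w => f w = v)).card := by
    refine card_le_card_of_injOn (fun w => w ^^^ 2 ^ j) ?_ ?_
    · intro w hw
      rw [mem_coe, mem_filter, hS, mem_filter, mem_range] at hw
      obtain ⟨⟨hwK, hPw⟩, hfw⟩ := hw
      rw [mem_coe, mem_filter, hS, mem_filter, mem_range]
      exact ⟨⟨Nat.xor_lt_two_pow hwK h2K, hP w hwK hPw⟩, by rw [hf w hwK hPw]; exact flip _ _ hfw⟩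
    · intro w _ w' _ h
      have h' : w ^^^ 2 ^ j ^^^ 2 ^ j = w' ^^^ 2 ^ j ^^^ 2 ^ j := by
        simp only at h
        rw [h]
      rwa [Nat.xor_xor_cancel_right, Nat.xor_xor_cancel_right] at h'
  have hsub : (S.filter (fun w => f w = v)).card ≤ ((range (2 ^ K)).filter (fun w => f w = v)).card :=
    card_le_card (fun w hw => by
      rw [mem_filter, hS, mem_filter] at hw
      exact mem_filter.mpr ⟨hw.1.1, hw.2⟩)
  omega

/-- Counting a predicate of `w mod 2^a` over `w < 2^K`, `a ≤ K`. -/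
theorem card_filter_mod (K a : ℕ) (haK : a ≤ K) (Q : ℕ → Prop) [DecidablePred Q] :
    ((range (2 ^ K)).filter (fun w => Q (w % 2 ^ a))).card =
      2 ^ (K - a) * ((range (2 ^ a)).filter Q).card := by
  have hper := card_filter_periodic (fun w => Q (w % 2 ^ a)) (2 ^ a)
    (fun T => by rw [Nat.add_mod_right]) (2 ^ (K - a))
  rw [← pow_add, Nat.add_sub_cancel' haK] at hper
  rw [hper]
  congr 1
  exact congrArg Finset.card (filter_congr fun w hw => by rw [Nat.mod_eq_of_lt (mem_range.mp hw)])

/-! ## Carry arithmetic for the second pairing -/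

/-- Flipping the parity of the high digit `A` changes `⌊(pA + ρ)/2⌋` by `ρ + (p-1)/2` modulo `2`. -/
theorem carry_cast_flip (p p' ρ A : ℕ) (hp : p = 2 * p' + 1) :
    (((p * (A ^^^ 1) + ρ) / 2 : ℕ) : ZMod 2) = (((p * A + ρ) / 2 : ℕ) : ZMod 2) + (ρ + p') := by
  have key : ∀ B, (((p * (2 * B + 1) + ρ) / 2 : ℕ) : ZMod 2) = (((p * (2 * B) + ρ) / 2 : ℕ) : ZMod 2) + (ρ + p') := by
    intro B
    rw [show p * (2 * B + 1) + ρ = (ρ + (2 * p' + 1)) + 2 * (p * B) by rw [hp]; ring,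
      show p * (2 * B) + ρ = ρ + 2 * (p * B) by ring, Nat.add_mul_div_left _ _ two_pos,
      Nat.add_mul_div_left _ _ two_pos, Nat.cast_add, Nat.cast_add, cast_half_add_odd]
    ring
  rcases Nat.even_or_odd A with ⟨B, hB⟩ | ⟨B, hB⟩
  · rw [Nat.xor_one_of_even ⟨B, hB⟩, hB, ← two_mul, key]
  · rw [Nat.xor_one_of_odd ⟨B, hB⟩, hB, Nat.add_sub_cancel, key]
    have := CharTwo.add_self_eq_zero ((ρ : ZMod 2) + p')
    linear_combination -this

/-- The carry into position `a + 1` through the quotient and the carry into position `a`: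
`⌊(px + r)/2^(a+1)⌋ = ⌊(p ⌊x/2^a⌋ + ⌊(p (x mod 2^a) + r)/2^a⌋)/2⌋`. -/
theorem carry_split (p r x a : ℕ) :
    (p * x + r) / 2 ^ (a + 1) = (p * (x / 2 ^ a) + (p * (x % 2 ^ a) + r) / 2 ^ a) / 2 := by
  conv_lhs => rw [← Nat.div_add_mod x (2 ^ a)]
  rw [show p * (2 ^ a * (x / 2 ^ a) + x % 2 ^ a) + r = 2 ^ a * (p * (x / 2 ^ a)) + (p * (x % 2 ^ a) + r) by ring,
    pow_succ, ← Nat.div_div_eq_div_mul, Nat.mul_add_div (Nat.two_pow_pos a)]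

/-- Second-pairing identity: flipping the input bit `a` changes `⌊(px + r)/2^(a+1)⌋` modulo `2` by
`⌊(p (x mod 2^a) + r)/2^a⌋ + (p-1)/2`. -/
theorem carry_cast_flip_bit (p p' r x a : ℕ) (hp : p = 2 * p' + 1) :
    (((p * (x ^^^ 2 ^ a) + r) / 2 ^ (a + 1) : ℕ) : ZMod 2) =
      (((p * x + r) / 2 ^ (a + 1) : ℕ) : ZMod 2) + (((p * (x % 2 ^ a) + r) / 2 ^ a : ℕ) + p') := by
  rw [carry_split, carry_split p r x a, xor_two_pow_mod_of_le x le_rfl, Nat.xor_div_two_pow,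
    Nat.div_self (Nat.two_pow_pos a), carry_cast_flip p p' _ _ hp]

/-! ## The two-level window pairing -/

/-- WINDOW PAIRING: if `f (w ⊕ 2^(k-1)) = f w + ρ(w) + ρ'(w) + E(w mod 2^(k-2))` on `w < 2^K`, where
`ρ, ρ'` are the carries `⌊(p (w mod 2^(k-1)) + r)/2^(k-1)⌋`, `⌊(q (w mod 2^(k-1)) + r')/2^(k-1)⌋` modulo `2`
(`p ≠ q` odd, `r < p`, `r' < q`, `2 ≤ k ≤ K`, `2^(k-2) ≥ 4pq`), then `f` takes each value on at least
`2^K/(8pq)` of the `w < 2^K`. -/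
theorem window_pairing (p q p' q' r r' k K : ℕ) (hp : p = 2 * p' + 1) (hq : q = 2 * q' + 1) (hpq : p ≠ q)
    (hr : r < p) (hr' : r' < q) (hk : 2 ≤ k) (hkK : k ≤ K) (hL : 4 * (p * q) ≤ 2 ^ (k - 2))
    (f E : ℕ → ZMod 2)
    (hf : ∀ w, w < 2 ^ K → f (w ^^^ 2 ^ (k - 1)) = f w +
      ((((p * (w % 2 ^ (k - 1)) + r) / 2 ^ (k - 1) : ℕ) : ZMod 2) +
        (((q * (w % 2 ^ (k - 1)) + r') / 2 ^ (k - 1) : ℕ) : ZMod 2) + E (w % 2 ^ (k - 2))))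
    (v : ZMod 2) :
    2 ^ K ≤ 8 * (p * q) * ((range (2 ^ K)).filter (fun w => f w = v)).card := by
  obtain ⟨a, rfl⟩ : ∃ a, k = a + 2 := ⟨k - 2, by omega⟩
  simp only [Nat.add_sub_cancel, show a + 2 - 1 = a + 1 from rfl] at hf hL ⊢
  have hp0 : 0 < p := by omega
  have hq0 : 0 < q := by omega
  -- the first difference `Δ₁` (a function of `w mod 2^(a+1)`) and the second difference `Δ₂`
  obtain ⟨Δ₁, hΔ₁⟩ : ∃ Δ₁ : ℕ → ZMod 2, ∀ x, Δ₁ x = (((p * x + r) / 2 ^ (a + 1) : ℕ) : ZMod 2) +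
      (((q * x + r') / 2 ^ (a + 1) : ℕ) : ZMod 2) + E (x % 2 ^ a) := ⟨_, fun _ => rfl⟩
  obtain ⟨Δ₂, hΔ₂⟩ : ∃ Δ₂ : ℕ → ZMod 2, ∀ x, Δ₂ x = (((p * x + r) / 2 ^ a : ℕ) : ZMod 2) +
      (((q * x + r') / 2 ^ a : ℕ) : ZMod 2) + (p' + q') := ⟨_, fun _ => rfl⟩
  have hmodmod : ∀ w, w % 2 ^ (a + 1) % 2 ^ a = w % 2 ^ a := fun w =>
    Nat.mod_mod_of_dvd w (Nat.pow_dvd_pow 2 (Nat.le_succ a))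
  -- level 1: `f` flips along `w ↔ w ⊕ 2^(a+1)` on `{Δ₁ (w mod 2^(a+1)) = 1}`
  have h1 : ((range (2 ^ K)).filter (fun w => Δ₁ (w % 2 ^ (a + 1)) = 1)).card ≤
      2 * ((range (2 ^ K)).filter (fun w => f w = v)).card := by
    refine card_le_two_mul_of_flip K (a + 1) (by omega) f _ (fun w _ hw => ?_) (fun w hwK hw => ?_) v
    · rwa [xor_two_pow_mod_of_le w le_rfl]
    · rw [hf w hwK, ← hmodmod, ← hΔ₁, hw]
  -- level 1 count: periodicity in `w mod 2^(a+1)`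
  have h1c := card_filter_mod K (a + 1) (by omega) (fun x => Δ₁ x = 1)
  -- level 2: `Δ₁` flips along `x ↔ x ⊕ 2^a` on `{Δ₂ (x mod 2^a) = 1}`
  have hflip2 : ∀ x, Δ₁ (x ^^^ 2 ^ a) = Δ₁ x + Δ₂ (x % 2 ^ a) := by
    intro x
    rw [hΔ₁, hΔ₁, hΔ₂, carry_cast_flip_bit p p' r x a hp, carry_cast_flip_bit q q' r' x a hq,
      xor_two_pow_mod_of_le x le_rfl]
    ring
  have h2 : ((range (2 ^ (a + 1))).filter (fun x => Δ₂ (x % 2 ^ a) = 1)).card ≤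
      2 * ((range (2 ^ (a + 1))).filter (fun x => Δ₁ x = 1)).card := by
    refine card_le_two_mul_of_flip (a + 1) a (Nat.lt_succ_self a) Δ₁ _ (fun x _ hx => ?_)
      (fun x _ hx => ?_) 1
    · rwa [xor_two_pow_mod_of_le x le_rfl]
    · rw [hflip2, hx]
  have h2c := card_filter_mod (a + 1) a (Nat.le_succ a) (fun x => Δ₂ x = 1)
  rw [Nat.add_sub_cancel_left, pow_one] at h2c
  -- level 3: both parities of `ρ₂ + ρ₂'` occur (distinct `p`, `q`)
  have h3 : 2 ^ a / (p * q) - 1 ≤ ((range (2 ^ a)).filter (fun x => Δ₂ x = 1)).card := by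
    have h := card_parity_ge p q r r' (2 ^ a) hp0 hq0 hpq hr hr' (1 - ((p' : ZMod 2) + q'))
    refine le_trans h (le_of_eq (congrArg Finset.card (filter_congr fun x _ => ?_)))
    rw [hΔ₂]
    constructor
    · intro h; linear_combination h
    · intro h; linear_combination h
  -- assembly of the inequalities
  have key := le_two_mul_of_le (2 ^ a) (p * q) (Nat.mul_pos hp0 hq0) hL
  have hK : 2 ^ K = 2 ^ (K - (a + 1)) * 2 * 2 ^ a := by
    rw [← pow_succ, ← pow_add]; congr 1; omega
  generalize 2 ^ a / (p * q) - 1 = D₀ at key h3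
  set C := ((range (2 ^ K)).filter (fun w => f w = v)).card
  set D₁ := ((range (2 ^ (a + 1))).filter (fun x => Δ₁ x = 1)).card
  set D₂ := ((range (2 ^ a)).filter (fun x => Δ₂ x = 1)).card
  rw [h1c] at h1
  rw [h2c] at h2
  calc 2 ^ K = 2 ^ (K - (a + 1)) * 2 * 2 ^ a := hK
    _ ≤ 2 ^ (K - (a + 1)) * 2 * (2 * (p * q * D₀)) := Nat.mul_le_mul_left _ key
    _ = 4 * (p * q) * (2 ^ (K - (a + 1)) * D₀) := by ring
    _ ≤ 4 * (p * q) * (2 ^ (K - (a + 1)) * D₁) :=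
        Nat.mul_le_mul_left _ (Nat.mul_le_mul_left _ (by omega))
    _ ≤ 4 * (p * q) * (2 * C) := Nat.mul_le_mul_left _ h1
    _ = 8 * (p * q) * C := by ring

/-! ## From the half-flip identity to the window hypothesis of `stub_condCount` -/

/-- Residue of a two-block number `2^s A + lo` (`lo < 2^s`) modulo `2^(s+a)`. -/
theorem mod_block (s a A lo : ℕ) (hlo : lo < 2 ^ s) :
    (2 ^ s * A + lo) % 2 ^ (s + a) = 2 ^ s * (A % 2 ^ a) + lo := by
  have hdm := Nat.div_add_mod A (2 ^ a)
  have hml : A % 2 ^ a < 2 ^ a := Nat.mod_lt _ (Nat.two_pow_pos a)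
  have h1 : 2 ^ s * A + lo = 2 ^ (s + a) * (A / 2 ^ a) + (2 ^ s * (A % 2 ^ a) + lo) := by
    rw [pow_add]
    conv_lhs => rw [← hdm]
    ring
  have h2 : 2 ^ s * (A % 2 ^ a) + lo < 2 ^ (s + a) := by
    calc 2 ^ s * (A % 2 ^ a) + lo < 2 ^ s * (A % 2 ^ a) + 2 ^ s := by omega
      _ = 2 ^ s * (A % 2 ^ a + 1) := by ring
      _ ≤ 2 ^ s * 2 ^ a := Nat.mul_le_mul_left _ hml
      _ = 2 ^ (s + a) := (pow_add 2 s a).symm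
  rw [h1, Nat.mul_add_mod, Nat.mod_eq_of_lt h2]

/-- Quotient of `p (2^s A + lo)` by `2^(s+a)` through the carry `⌊p·lo/2^s⌋`. -/
theorem mul_block_div (p s a A lo : ℕ) :
    p * (2 ^ s * A + lo) / 2 ^ (s + a) = (p * A + p * lo / 2 ^ s) / 2 ^ a := by
  rw [pow_add, ← Nat.div_div_eq_div_mul,
    Summit.QuantumAdvantage.QuantumAdvantage.Theorems.MobiusLadderQuadraticDigitPhasesStubFlipGood.mul_blocks_div]

/-- WINDOW BOUND: an `𝔽₂`-valued `F` with the perturbed half-flip identity at the pivot `m`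
(`F (X ⊕ 2^(m-1)) = F X + ⌊p (X mod 2^(m-1))/2^(m-1)⌋ + ⌊q (X mod 2^(m-1))/2^(m-1)⌋ + D (X mod 2^(m-2))`)
vanishes on at most `(1 - 1/(8pq)) 2^(k+1)` members of every window class `[m-k, m]` of `stub_condCount`
(`2 ≤ k ≤ m`, `2^(k-2) ≥ 4pq`, `p ≠ q` odd). -/
theorem window_bound (p q p' q' m k : ℕ) (hp : p = 2 * p' + 1) (hq : q = 2 * q' + 1) (hpq : p ≠ q)
    (hk : 2 ≤ k) (hkm : k ≤ m) (hL : 4 * (p * q) ≤ 2 ^ (k - 2)) (F D : ℕ → ZMod 2)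
    (hF : ∀ X, F (X ^^^ 2 ^ (m - 1)) = F X + (((p * (X % 2 ^ (m - 1)) / 2 ^ (m - 1) : ℕ) : ZMod 2) +
      ((q * (X % 2 ^ (m - 1)) / 2 ^ (m - 1) : ℕ) : ZMod 2) + D (X % 2 ^ (m - 2)))) (T : ℕ) :
    ((((range (2 ^ (k + 1))).filter (fun w =>
        F (T - (T / 2 ^ (m - k) % 2 ^ (k + 1)) * 2 ^ (m - k) + w * 2 ^ (m - k)) = 0)).card : ℕ) : ℝ) ≤
      (1 - 1 / (8 * (p * q))) * (2 : ℝ) ^ (k + 1) := by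
  obtain ⟨a, rfl⟩ : ∃ a, k = a + 2 := ⟨k - 2, by omega⟩
  obtain ⟨s, rfl⟩ : ∃ s, m = s + (a + 2) := ⟨m - (a + 2), by omega⟩
  simp only [Nat.add_sub_cancel, show s + (a + 2) - 1 = s + (a + 1) by omega,
    show s + (a + 2) - 2 = s + a by omega] at hF hL ⊢
  have hp0 : 0 < p := by omega
  have hq0 : 0 < q := by omega
  have hs : 0 < 2 ^ s := Nat.two_pow_pos s
  set Z := T - (T / 2 ^ s % 2 ^ (a + 2 + 1)) * 2 ^ s with hZdef
  set hi := T / 2 ^ s / 2 ^ (a + 2 + 1) with hhi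
  set lo := T % 2 ^ s with hlo
  have hlos : lo < 2 ^ s := Nat.mod_lt _ hs
  have hZ : Z = hi * 2 ^ (a + 2 + 1) * 2 ^ s + lo := sub_window T (2 ^ s) (2 ^ (a + 2 + 1))
  have hX : ∀ w, Z + w * 2 ^ s = 2 ^ s * (2 ^ (a + 3) * hi + w) + lo := by
    intro w; rw [hZ, show a + 2 + 1 = a + 3 by ring]; ring
  have hr : p * lo / 2 ^ s < p :=
    Nat.div_lt_of_lt_mul (by rw [mul_comm (2 ^ s) p]; exact Nat.mul_lt_mul_of_pos_left hlos hp0)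
  have hr' : q * lo / 2 ^ s < q :=
    Nat.div_lt_of_lt_mul (by rw [mul_comm (2 ^ s) q]; exact Nat.mul_lt_mul_of_pos_left hlos hq0)
  -- the window function and its half-flip identity
  obtain ⟨f, hf⟩ : ∃ f : ℕ → ZMod 2, ∀ w, f w = F (Z + w * 2 ^ s) := ⟨_, fun _ => rfl⟩
  have hmodw : ∀ w c, (2 ^ (a + 3) * hi + w) % 2 ^ (a + c) = w % 2 ^ (a + c) ∨ 3 < c := by
    intro w c
    by_cases hc : c ≤ 3
    · left
      obtain ⟨e, he⟩ : ∃ e, a + 3 = (a + c) + e := ⟨3 - c, by omega⟩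
      rw [he, pow_add, mul_assoc, Nat.mul_add_mod]
    · right; omega
  have hmod1 : ∀ w, (2 ^ (a + 3) * hi + w) % 2 ^ (a + 1) = w % 2 ^ (a + 1) := fun w =>
    (hmodw w 1).resolve_right (by norm_num)
  have hmod0 : ∀ w, (2 ^ (a + 3) * hi + w) % 2 ^ (a + 0) = w % 2 ^ (a + 0) := fun w =>
    (hmodw w 0).resolve_right (by norm_num)
  simp only [Nat.add_zero] at hmod0
  have hflip : ∀ w, w < 2 ^ (a + 2 + 1) → f (w ^^^ 2 ^ (a + 1)) = f w +
      ((((p * (w % 2 ^ (a + 1)) + p * lo / 2 ^ s) / 2 ^ (a + 1) : ℕ) : ZMod 2) +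
        (((q * (w % 2 ^ (a + 1)) + q * lo / 2 ^ s) / 2 ^ (a + 1) : ℕ) : ZMod 2) +
        D (2 ^ s * (w % 2 ^ a) + lo)) := by
    intro w hw
    have hw' : w < 2 ^ (a + 3) := hw
    have h21 : 2 ^ (a + 1) < 2 ^ (a + 3) := Nat.pow_lt_pow_right (by norm_num) (by omega)
    have hxor : Z + (w ^^^ 2 ^ (a + 1)) * 2 ^ s = (Z + w * 2 ^ s) ^^^ 2 ^ (s + (a + 1)) := by
      rw [hX, hX]
      have h1 := xor_blocks s (2 ^ (a + 3) * hi + w) (2 ^ (a + 1)) lo 0 hlos hs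
      rw [add_zero, Nat.xor_zero, ← pow_add] at h1
      have h2 := xor_blocks (a + 3) hi 0 w (2 ^ (a + 1)) hw' h21
      rw [mul_zero, zero_add, Nat.xor_zero] at h2
      rw [h1, h2]
    rw [hf, hf, hxor, hF, hX, mod_block s (a + 1) _ lo hlos, mod_block s a _ lo hlos, hmod1, hmod0,
      mul_block_div, mul_block_div]
  have hwin := window_pairing p q p' q' (p * lo / 2 ^ s) (q * lo / 2 ^ s) (a + 2) (a + 2 + 1) hp hq hpq
    hr hr' (by omega) (by omega) (by simpa using hL) f (fun x => D (2 ^ s * x + lo))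
    (fun w hw => by simpa using hflip w hw) 1
  -- from the count of the value `1` to the bound on the value `0`
  have hsplit := card_filter_add_card_filter_not (s := range (2 ^ (a + 2 + 1))) (fun w => f w = 0)
  have hneg : ((range (2 ^ (a + 2 + 1))).filter (fun w => ¬ f w = 0)) =
      (range (2 ^ (a + 2 + 1))).filter (fun w => f w = 1) :=
    filter_congr fun w _ => by
      have : ∀ x : ZMod 2, ¬ x = 0 ↔ x = 1 := by decide
      exact this _
  rw [card_range, hneg] at hsplit
  have hfilter : (range (2 ^ (a + 2 + 1))).filter (fun w => F (Z + w * 2 ^ s) = 0) =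
      (range (2 ^ (a + 2 + 1))).filter (fun w => f w = 0) := filter_congr fun w _ => by rw [hf]
  rw [hfilter]
  have hpq0 : (0 : ℝ) < 8 * (p * q) := by positivity
  have e1 : (((range (2 ^ (a + 2 + 1))).filter (fun w => f w = 0)).card : ℝ) +
      (((range (2 ^ (a + 2 + 1))).filter (fun w => f w = 1)).card : ℝ) = (2 : ℝ) ^ (a + 2 + 1) := by
    exact_mod_cast hsplit
  have e2 : (2 : ℝ) ^ (a + 2 + 1) ≤
      8 * (p * q) * (((range (2 ^ (a + 2 + 1))).filter (fun w => f w = 1)).card : ℝ) := by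
    exact_mod_cast hwin
  have e3 : (2 : ℝ) ^ (a + 2 + 1) / (8 * (p * q)) ≤
      (((range (2 ^ (a + 2 + 1))).filter (fun w => f w = 1)).card : ℝ) := by
    rw [div_le_iff₀ hpq0]; linarith
  rw [show (1 - 1 / (8 * ((p : ℝ) * q))) * (2 : ℝ) ^ (a + 2 + 1) =
    2 ^ (a + 2 + 1) - 2 ^ (a + 2 + 1) / (8 * (p * q)) by ring]
  linarith

/-- COUNTING THE JOINT ZERO SET: `d` functions `F j` with pivots `top j` (`k ≤ top j < N`, gaps `> k`,
`2^(k-2) ≥ 4pq`), each local below its pivot (`F j` only sees `T mod 2^(top j + 1)`) and each satisfying the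
perturbed half-flip identity at its pivot, vanish simultaneously on at most `(1 - 1/(8pq))^d 2^N` inputs
`T < 2^N` (`stub_condCount` with the window bound `window_bound`). -/
theorem count_events (p q p' q' N d k : ℕ) (hp : p = 2 * p' + 1) (hq : q = 2 * q' + 1) (hpq : p ≠ q)
    (hk : 2 ≤ k) (hL : 4 * (p * q) ≤ 2 ^ (k - 2)) (top : Fin d → ℕ) (F D : Fin d → ℕ → ZMod 2)
    (h1 : ∀ j, k ≤ top j ∧ top j < N) (h2 : ∀ i j : Fin d, i < j → top i + k < top j)
    (h3 : ∀ j, ∀ T T' : ℕ, T % 2 ^ (top j + 1) = T' % 2 ^ (top j + 1) → F j T = F j T')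
    (h4 : ∀ j, ∀ X, F j (X ^^^ 2 ^ (top j - 1)) = F j X +
      (((p * (X % 2 ^ (top j - 1)) / 2 ^ (top j - 1) : ℕ) : ZMod 2) +
        ((q * (X % 2 ^ (top j - 1)) / 2 ^ (top j - 1) : ℕ) : ZMod 2) + D j (X % 2 ^ (top j - 2)))) :
    (((range (2 ^ N)).filter (fun T => ∀ j, F j T = 0)).card : ℝ) ≤
      (1 - 1 / (8 * (p * q))) ^ d * (2 : ℝ) ^ N := by
  have h := stub_condCount N d k (1 / (8 * (p * q))) top (fun j T => decide (F j T = 0)) h1 h2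
    (fun j T T' hTT' => by rw [h3 j T T' hTT'])
    (fun j T => by
      have hw := window_bound p q p' q' (top j) k hp hq hpq hk (h1 j).1 hL (F j) (D j) (h4 j) T
      refine le_trans (le_of_eq ?_) hw
      congr 2
      exact filter_congr fun w _ => decide_eq_true_iff)
  refine le_trans (le_of_eq ?_) h
  congr 2
  exact filter_congr fun T _ => by simp only [decide_eq_true_eq]

/-- MAIN STATEMENT of this helper file (registered campaign stub toward `stub_tameCore`): the joint zero set of
`d` pivot-local functions with the perturbed half-flip identity at pivots increasing by more than `k`
(`2^(k-2) ≥ 4pq`) has at most `(1 - 1/(8pq))^d 2^N` elements below `2^N`. -/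
theorem stub_tameCoreWindow : ∀ (p q p' q' N d k : ℕ), p = 2 * p' + 1 → q = 2 * q' + 1 → p ≠ q → 2 ≤ k → 4 * (p * q) ≤ 2 ^ (k - 2) → ∀ (top : Fin d → ℕ) (F D : Fin d → ℕ → ZMod 2), (∀ j, k ≤ top j ∧ top j < N) → (∀ i j : Fin d, i < j → top i + k < top j) → (∀ j, ∀ T T' : ℕ, T % 2 ^ (top j + 1) = T' % 2 ^ (top j + 1) → F j T = F j T') → (∀ j, ∀ X, F j (X ^^^ 2 ^ (top j - 1)) = F j X + (((p * (X % 2 ^ (top j - 1)) / 2 ^ (top j - 1) : ℕ) : ZMod 2) + ((q * (X % 2 ^ (top j - 1)) / 2 ^ (top j - 1) : ℕ) : ZMod 2) + D j (X % 2 ^ (top j - 2)))) → ((((Finset.range (2 ^ N)).filter (fun T => ∀ j, F j T = 0)).card : ℕ) : ℝ) ≤ (1 - 1 / (8 * (p * q))) ^ d * (2 : ℝ) ^ N := by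
  intro p q p' q' N d k hp hq hpq hk hL top F D h1 h2 h3 h4
  exact count_events p q p' q' N d k hp hq hpq hk hL top F D h1 h2 h3 h4

end Summit.QuantumAdvantage.QuantumAdvantage.Theorems.MobiusLadderQuadraticDigitPhasesStubTameCoreWindow
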